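import Literature.Algebra.Homology.GroupCohomologySemilinear
import Mathlib.Algebra.Module.Submodule.Pointwise
import HarnessLib

/-!
# The kernel of `Hⁿ(s)` for a surjective coefficient map: `ker Hⁿ(s) = im Hⁿ(ker s)`

Topic `Algebra/Homology`; namespace `Literature.Algebra.Homology`; theorems only, continuing
`GroupCohomologySemilinear`.  Exactness at `Hⁿ(G, A)` of the long exact sequence of a short exact
sequence of coefficients `0 → C →t A →s B → 0` in the SEMILINEAR setting of that file (`s`
semilinear over a ring homomorphism `σ : k → k'`, e.g. reduction of an `𝒪`-lattice modulo `ϖ` with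
`B` a representation over `𝒪/ϖ`; `t` linear over `k`):

* `semimap_semimap_eq_zero_of_comp_eq_zero` — `Hⁿ(s) ∘ Hⁿ(t) = 0` when `s ∘ t = 0`;
* **`ker_semimap_eq_range_semimap`** — **`ker Hⁿ(s) = range Hⁿ(t)`** when `t` is injective with
  image `ker s` and `s` is surjective (diagram chase on inhomogeneous cochains);
* `semimap_smul_id` — `Hⁿ(ϖ · id) = ϖ · id`; hence
* **`ker_semimap_eq_smul_top`** — for `s` surjective with `ker s = ϖ A` and `ϖ` injective on `A`:
  **`ker (Hⁿ(G, A) → Hⁿ(G, B)) = ϖ Hⁿ(G, A)`**, i.e. `Hⁿ(G, A)/ϖ ↪ Hⁿ(G, B)` — the universal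
  coefficient injection used to compare `p`-adic and mod-`pⁿ` (ordinary) cohomology in Hida theory
  ([Hida1994AIF, §3]; [KhareThorne2017, §6.4]).

[Brown1982CohomologyGroups, III.6 Prop. 6.1 (long exact sequence)]

## References

* K. S. Brown, *Cohomology of Groups*, GTM 87 (1982), III.6 (held). [Brown1982CohomologyGroups]
* H. Hida, Ann. Inst. Fourier 44 (1994), §3 (held). [Hida1994AIF]
-/

noncomputable section

open CategoryTheory groupCohomology
open scoped Pointwise

namespace Literature.Algebra.Homology

universe u

variable {k k' : Type u} [CommRing k] [CommRing k'] {G : Type u} [Group G]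
variable {σ : k →+* k'} {C A : Rep k G} {B : Rep k' G}

/-- `Hⁿ(s) (Hⁿ(t) x) = 0` when `s ∘ t = 0`. [folklore] -/
theorem semimap_semimap_eq_zero_of_comp_eq_zero (t : C.V →ₗ[k] A.V)
    (ht : ∀ (g : G) (c : C.V), t (C.ρ g c) = A.ρ g (t c)) (s : A.V →ₛₗ[σ] B.V)
    (hs : ∀ (g : G) (a : A.V), s (A.ρ g a) = B.ρ g (s a)) (hst : ∀ c, s (t c) = 0) (n : ℕ)
    (x : groupCohomology C n) : semimap s hs n (semimap t ht n x) = 0 := by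
  induction x using groupCohomology_induction_on with
  | h z =>
    rw [semimap_π, semimap_π]
    have h0 : cocyclesSemimap s hs n (cocyclesSemimap t ht n z) = 0 := by
      refine iCocycles_injective B n ?_
      rw [iCocycles_cocyclesSemimap, iCocycles_cocyclesSemimap, map_zero]
      funext g
      rw [cochainsSemimap_apply, cochainsSemimap_apply, hst]
      rfl
    rw [h0, map_zero]

/-- **Exactness at `Hⁿ(G, A)`: `ker Hⁿ(s) = range Hⁿ(t)`** for `0 → C →t A →s B → 0` exact
(`t` injective, `range t = ker s`, `s` surjective). [cite: Brown1982CohomologyGroups, III.6 Prop. 6.1] -/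
theorem ker_semimap_eq_range_semimap (t : C.V →ₗ[k] A.V)
    (ht : ∀ (g : G) (c : C.V), t (C.ρ g c) = A.ρ g (t c)) (s : A.V →ₛₗ[σ] B.V)
    (hs : ∀ (g : G) (a : A.V), s (A.ρ g a) = B.ρ g (s a)) (htinj : Function.Injective t)
    (hexact : ∀ a, s a = 0 ↔ a ∈ LinearMap.range t) (hsurj : Function.Surjective s) (n : ℕ) :
    LinearMap.ker (semimap s hs n) = LinearMap.range (semimap t ht n) := by
  refine le_antisymm (fun x hx => ?_) ?_
  · rw [LinearMap.mem_ker] at hx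
    induction x using groupCohomology_induction_on with
    | h z =>
      rw [semimap_π] at hx
      obtain ⟨w', hw'⟩ := (π_apply_eq_zero_iff B n _).1 hx
      -- lift the cochain `w'` along the surjection `s`
      choose lift hlift using hsurj
      let w : (inhomogeneousCochains A).X (n - 1) := fun g => lift (w' g)
      have hw : cochainsSemimap s (n - 1) w = w' := funext fun g => hlift (w' g)
      let z₁ : cocycles A n := z - toCocycles A (n - 1) n w
      have hz₁ : groupCohomology.π A n z₁ = groupCohomology.π A n z := by
        rw [map_sub, π_toCocycles, sub_zero]
      have hsz₁ : cocyclesSemimap s hs n z₁ = 0 := by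
        rw [map_sub, cocyclesSemimap_toCocycles s hs, hw, hw', sub_self]
      -- `z₁` takes values in `ker s = range t`
      have hval : ∀ g, ∃ c, t c = iCocycles A n z₁ g := fun g => by
        have h0 : s (iCocycles A n z₁ g) = 0 := by
          have h1 := congrFun (iCocycles_cocyclesSemimap s hs n z₁) g
          rw [hsz₁, map_zero, cochainsSemimap_apply] at h1
          exact h1.symm
        obtain ⟨c, hc⟩ := (hexact _).1 h0
        exact ⟨c, hc⟩
      choose y hy using hval
      have hty : cochainsSemimap (σ := RingHom.id k) t n y = iCocycles A n z₁ := funext hy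
      have hdy : inhomogeneousCochains.d C n y = 0 := by
        have hinj : Function.Injective (cochainsSemimap (σ := RingHom.id k) (A := C) (B := A) t (n + 1)) :=
          fun f f' hff' => funext fun g => htinj (congrFun hff' g)
        refine hinj ?_
        rw [← d_cochainsSemimap t ht, hty, d_iCocycles, map_zero]
      refine ⟨groupCohomology.π C n (cocyclesMk y hdy), ?_⟩
      rw [semimap_π, ← hz₁]
      congr 1
      refine iCocycles_injective A n ?_
      rw [iCocycles_cocyclesSemimap, iCocycles_mk, hty]
  · rintro _ ⟨x, rfl⟩
    rw [LinearMap.mem_ker]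
    exact semimap_semimap_eq_zero_of_comp_eq_zero t ht s hs (fun c => (hexact _).2 ⟨c, rfl⟩) n x

/-- `ϖ · id` is equivariant. [folklore] -/
theorem smul_id_equivariant (ϖ : k) (g : G) (a : A.V) :
    (ϖ • LinearMap.id : A.V →ₗ[k] A.V) (A.ρ g a) = A.ρ g ((ϖ • LinearMap.id : A.V →ₗ[k] A.V) a) := by
  simp only [LinearMap.smul_apply, LinearMap.id_apply, map_smul]

/-- `Hⁿ(ϖ · id) = ϖ · id`. [folklore] -/
theorem semimap_smul_id (ϖ : k) (n : ℕ) (x : groupCohomology A n) :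
    semimap (σ := RingHom.id k) (ϖ • LinearMap.id : A.V →ₗ[k] A.V) (smul_id_equivariant ϖ) n x = ϖ • x := by
  induction x using groupCohomology_induction_on with
  | h z =>
    rw [semimap_π, ← map_smul]
    congr 1
    refine iCocycles_injective A n ?_
    rw [iCocycles_cocyclesSemimap, map_smul]
    rfl

/-- **`ker (Hⁿ(G, A) → Hⁿ(G, B)) = ϖ Hⁿ(G, A)`** for a surjective coefficient map `s` with
`ker s = ϖ A` and `ϖ` injective on `A` (e.g. reduction of a `ϖ`-torsion-free lattice modulo `ϖ`):
the universal coefficient injection `Hⁿ(G, A)/ϖ ↪ Hⁿ(G, B)`.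
[cite: Brown1982CohomologyGroups, III.6 Prop. 6.1] [cite: Hida1994AIF, §3] -/
theorem ker_semimap_eq_smul_top (ϖ : k) (htf : ∀ a : A.V, ϖ • a = 0 → a = 0) (s : A.V →ₛₗ[σ] B.V)
    (hs : ∀ (g : G) (a : A.V), s (A.ρ g a) = B.ρ g (s a))
    (hker : ∀ a, s a = 0 ↔ ∃ a', ϖ • a' = a) (hsurj : Function.Surjective s) (n : ℕ) :
    LinearMap.ker (semimap s hs n) = ϖ • (⊤ : Submodule k (groupCohomology A n)) := by
  have htinj : Function.Injective (ϖ • LinearMap.id : A.V →ₗ[k] A.V) := by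
    intro a b hab
    simp only [LinearMap.smul_apply, LinearMap.id_apply] at hab
    rw [← sub_eq_zero, ← smul_sub] at hab
    exact sub_eq_zero.1 (htf _ hab)
  have hexact : ∀ a, s a = 0 ↔ a ∈ LinearMap.range (ϖ • LinearMap.id : A.V →ₗ[k] A.V) := fun a => by
    rw [hker, LinearMap.mem_range]
    rfl
  rw [ker_semimap_eq_range_semimap (ϖ • LinearMap.id) (smul_id_equivariant ϖ) s hs htinj hexact hsurj n]
  ext x
  simp only [LinearMap.mem_range, semimap_smul_id]
  constructor
  · rintro ⟨y, rfl⟩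
    exact Submodule.smul_mem_pointwise_smul _ _ _ Submodule.mem_top
  · intro hx
    obtain ⟨y, -, rfl⟩ := (Submodule.mem_smul_pointwise_iff_exists _ _ _).1 hx
    exact ⟨y, rfl⟩

end Literature.Algebra.Homology
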